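import Literature.Computability.AlgebraicComplexity.BigCwSquareValue112
import Literature.Computability.AlgebraicComplexity.BigCoppersmithWinogradProofs
import HarnessLib

/-!
# `ω < 2.376` from the square of the Coppersmith–Winograd tensor (Coppersmith–Winograd 1990, §8) — proved

Topic `Literature/Computability/AlgebraicComplexity`.  D. Coppersmith, S. Winograd, *Matrix
multiplication via arithmetic progressions*, J. Symbolic Comput. 9 (1990), §8, analyse
`CW_q ⊗ CW_q` with the variables grouped by the sum of the two levels, value the four kinds of
components (`[004] = 1`, `[013] = (2q)^τ`, `[022] = (q²+2)^τ`, `[112] = 2^{2/3}q^τ(q^{3τ}+2)^{1/3}`),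
and obtain for `q = 6` the bound **`ω ≤ 3τ < 2.376`** (printed: `ω < 2.376`; the optimum of the
program is `2.375477`).  This file PROVES

* `CoppersmithWinograd1990_sec8 : ∀ fields K, omega K < 2.376`

by running the tree's formalisation of Le Gall's Thm. 4.1 (`omega_le_of_laserMethodSym`,
`LaserMethodValuesSym.lean`) on the level-2 decomposition of `CW_6^{⊗2}`
(`BigCwSquareComponents.lean`, `BigCwSquareValue112.lean`) with Coppersmith–Winograd's symmetric
distribution at the rational point `(α₀, β₀, γ₀, δ₀) = (1/2916, 49/3888, 605/5832, 595/2916)` (per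
ordered block; `3α₀ + 6β₀ + 3γ₀ + 3δ₀ = 1`), splitting parameter `σ = 35/36` for `[112]`, and
`ρ = 2.3759`: the penalty vanishes (the distribution has product form `f(I)f(J)f(K)`, with square
roots), the three marginals are `(7/54, 2527/5832, 100/243, 49/1944, 1/2916)`, `R̃(CW_6^{⊗2}) ≤ 64`,
and the final inequality `6 ln 2 < H(P_X) + ∑ P ln u` is a linear inequality in
`ln 2, ln 3, ln 5, ln 7, ln 19` (all the rationals involved are `{2,3,5,7,19}`-smooth) which holds
with margin `4.4·10⁻⁴` and is certified from `Real.log_two_gt_d9/lt_d9` and the Taylor bounds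
`Real.abs_log_sub_add_sum_range_le` for `ln(1−1/4), ln(1−1/5), ln(1−1/8), ln(1−1/20)`.

Everything is proved; definitions are the explicit numerical data; no named facts.

## References

* D. Coppersmith, S. Winograd, J. Symbolic Comput. 9 (1990) 251–280, §8 ("`ω < 2.376`").
  [CoppersmithWinograd1990]
* F. Le Gall, ISSAC 2014, arXiv:1401.7714, Thm. 4.1, §5, Table 3 (`CW_q^{⊗2}`: `2.3754770`).
  [LeGall2014]
-/

noncomputable section

open scoped BigOperators
open Finset Real

namespace Literature.Computability.AlgebraicComplexity

open Literature.Barriers.MatrixMultiplication (bigCwTensor)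

universe u

/-! ## Logarithms -/

section Logs

/-- Two-sided Taylor bound for `ln(1 − x)`, `0 ≤ x < 1`. [folklore] -/
theorem log_one_sub_bounds {x : ℝ} (hx0 : 0 ≤ x) (hx1 : x < 1) (n : ℕ) :
    -(∑ i ∈ range n, x ^ (i + 1) / (i + 1)) - x ^ (n + 1) / (1 - x) ≤ Real.log (1 - x) ∧
      Real.log (1 - x) ≤ -(∑ i ∈ range n, x ^ (i + 1) / (i + 1)) + x ^ (n + 1) / (1 - x) := by
  have h := Real.abs_log_sub_add_sum_range_le (x := x) (by rwa [abs_of_nonneg hx0]) n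
  rw [abs_of_nonneg hx0] at h
  rw [abs_le] at h
  constructor <;> linarith [h.1, h.2]

/-- `ln 3 ≥ 2 ln 2 − S − E` with the series for `ln(1 − 1/4)` (`3 = 4 (1 − 1/4)`). [folklore] -/
theorem log_three_ge_series : 2 * Real.log 2 - 66895348819 / 232532213760 - (1 / 4 : ℝ) ^ 13 / (3 / 4) ≤
    Real.log 3 := by
  have h := (log_one_sub_bounds (x := (1 / 4 : ℝ)) (by norm_num) (by norm_num) 12).1
  have hs : ∑ i ∈ range 12, (1 / 4 : ℝ) ^ (i + 1) / (i + 1) = 66895348819 / 232532213760 := by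
    simp only [sum_range_succ, sum_range_zero]; norm_num
  rw [hs] at h
  have e : Real.log 3 = 2 * Real.log 2 + Real.log (1 - 1 / 4) := by
    rw [show (1 : ℝ) - 1 / 4 = 3 / 4 by norm_num, Real.log_div (by norm_num) (by norm_num),
      show (4 : ℝ) = 2 ^ 2 by norm_num, Real.log_pow]; push_cast; ring
  rw [e]; norm_num at h ⊢; linarith

/-- `ln 5 ≤ 2 ln 2 + S + E` with the series for `ln(1 − 1/5)` (`5 = 4 / (1 − 1/5)`). [folklore] -/
theorem log_five_le_series : Real.log 5 ≤ 2 * Real.log 2 + 5491423277 / 24609375000 + (1 / 5 : ℝ) ^ 11 / (4 / 5) := by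
  have h := (log_one_sub_bounds (x := (1 / 5 : ℝ)) (by norm_num) (by norm_num) 10).1
  have hs : ∑ i ∈ range 10, (1 / 5 : ℝ) ^ (i + 1) / (i + 1) = 5491423277 / 24609375000 := by
    simp only [sum_range_succ, sum_range_zero]; norm_num
  rw [hs] at h
  have e : Real.log 5 = 2 * Real.log 2 - Real.log (1 - 1 / 5) := by
    rw [show (1 : ℝ) - 1 / 5 = 4 / 5 by norm_num, Real.log_div (by norm_num) (by norm_num),
      show (4 : ℝ) = 2 ^ 2 by norm_num, Real.log_pow]; push_cast; ring
  rw [e]; norm_num at h ⊢; linarith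

/-- `ln 7 ≤ 3 ln 2 − S + E` with the series for `ln(1 − 1/8)` (`7 = 8 (1 − 1/8)`). [folklore] -/
theorem log_seven_le_series : Real.log 7 ≤ 3 * Real.log 2 - 1881839401 / 14092861440 + (1 / 8 : ℝ) ^ 9 / (7 / 8) := by
  have h := (log_one_sub_bounds (x := (1 / 8 : ℝ)) (by norm_num) (by norm_num) 8).2
  have hs : ∑ i ∈ range 8, (1 / 8 : ℝ) ^ (i + 1) / (i + 1) = 1881839401 / 14092861440 := by
    simp only [sum_range_succ, sum_range_zero]; norm_num
  rw [hs] at h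
  have e : Real.log 7 = 3 * Real.log 2 + Real.log (1 - 1 / 8) := by
    rw [show (1 : ℝ) - 1 / 8 = 7 / 8 by norm_num, Real.log_div (by norm_num) (by norm_num),
      show (8 : ℝ) = 2 ^ 3 by norm_num, Real.log_pow]; push_cast; ring
  rw [e]; norm_num at h ⊢; linarith

/-- `ln 19 ≤ 2 ln 2 + ln 5 − S + E` with the series for `ln(1 − 1/20)` (`19 = 20 (1 − 1/20)`). [folklore] -/
theorem log_nineteen_le_series : Real.log 19 ≤ 2 * Real.log 2 + Real.log 5 - 157573 / 3072000 + (1 / 20 : ℝ) ^ 7 / (19 / 20) := by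
  have h := (log_one_sub_bounds (x := (1 / 20 : ℝ)) (by norm_num) (by norm_num) 6).2
  have hs : ∑ i ∈ range 6, (1 / 20 : ℝ) ^ (i + 1) / (i + 1) = 157573 / 3072000 := by
    simp only [sum_range_succ, sum_range_zero]; norm_num
  rw [hs] at h
  have e : Real.log 19 = 2 * Real.log 2 + Real.log 5 + Real.log (1 - 1 / 20) := by
    rw [show (1 : ℝ) - 1 / 20 = 19 / 20 by norm_num, Real.log_div (by norm_num) (by norm_num),
      show (20 : ℝ) = 2 ^ 2 * 5 by norm_num, Real.log_mul (by norm_num) (by norm_num), Real.log_pow]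
    push_cast; ring
  rw [e]; norm_num at h ⊢; linarith

/-- **The numerical core of Coppersmith–Winograd's `2.376` bound** at the rational point of this
file: `6 ln 2 < H(P_X) + ∑ P ln u` at `ρ = 2.3759`, as a linear inequality in
`ln 2, ln 3, ln 5, ln 7, ln 19`. [cite: CoppersmithWinograd1990, §8] -/
theorem cw_square_numeric_core :
    6 * Real.log 2 <
      (negMulLog (7 / 54 : ℝ) + negMulLog (2527 / 5832 : ℝ) + negMulLog (100 / 243 : ℝ) +
          negMulLog (49 / 1944 : ℝ) + negMulLog (1 / 2916 : ℝ)) +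
        ((2.3759 : ℝ) / 3 * (6 * (49 / 3888 : ℝ) * Real.log 12 + 3 * (605 / 5832 : ℝ) * Real.log 38 +
            3 * (595 / 2916 : ℝ) * (1 + 35 / 36) * Real.log 6) +
          (595 / 2916 : ℝ) * (2 * Real.log 2 + 2 * negMulLog (1 / 72 : ℝ) + negMulLog (35 / 36 : ℝ))) := by
  have h2l := Real.log_two_gt_d9
  have h2u := Real.log_two_lt_d9
  have h3 := log_three_ge_series
  have h5 := log_five_le_series
  have h7 := log_seven_le_series
  have h19 := log_nineteen_le_series
  -- logarithms of the smooth integers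
  have l12 : Real.log 12 = 2 * Real.log 2 + Real.log 3 := by
    rw [show (12 : ℝ) = 2 ^ 2 * 3 by norm_num, Real.log_mul (by norm_num) (by norm_num), Real.log_pow]; ring
  have l38 : Real.log 38 = Real.log 2 + Real.log 19 := by
    rw [show (38 : ℝ) = 2 * 19 by norm_num, Real.log_mul (by norm_num) (by norm_num)]
  have l6 : Real.log 6 = Real.log 2 + Real.log 3 := by
    rw [show (6 : ℝ) = 2 * 3 by norm_num, Real.log_mul (by norm_num) (by norm_num)]
  have l54 : Real.log 54 = Real.log 2 + 3 * Real.log 3 := by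
    rw [show (54 : ℝ) = 2 * 3 ^ 3 by norm_num, Real.log_mul (by norm_num) (by norm_num), Real.log_pow]; ring
  have l2527 : Real.log 2527 = Real.log 7 + 2 * Real.log 19 := by
    rw [show (2527 : ℝ) = 7 * 19 ^ 2 by norm_num, Real.log_mul (by norm_num) (by norm_num), Real.log_pow]; ring
  have l5832 : Real.log 5832 = 3 * Real.log 2 + 6 * Real.log 3 := by
    rw [show (5832 : ℝ) = 2 ^ 3 * 3 ^ 6 by norm_num, Real.log_mul (by norm_num) (by norm_num), Real.log_pow,
      Real.log_pow]; ring
  have l100 : Real.log 100 = 2 * Real.log 2 + 2 * Real.log 5 := by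
    rw [show (100 : ℝ) = 2 ^ 2 * 5 ^ 2 by norm_num, Real.log_mul (by norm_num) (by norm_num), Real.log_pow,
      Real.log_pow]; ring
  have l243 : Real.log 243 = 5 * Real.log 3 := by
    rw [show (243 : ℝ) = 3 ^ 5 by norm_num, Real.log_pow]; ring
  have l49 : Real.log 49 = 2 * Real.log 7 := by
    rw [show (49 : ℝ) = 7 ^ 2 by norm_num, Real.log_pow]; ring
  have l1944 : Real.log 1944 = 3 * Real.log 2 + 5 * Real.log 3 := by
    rw [show (1944 : ℝ) = 2 ^ 3 * 3 ^ 5 by norm_num, Real.log_mul (by norm_num) (by norm_num), Real.log_pow,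
      Real.log_pow]; ring
  have l2916 : Real.log 2916 = 2 * Real.log 2 + 6 * Real.log 3 := by
    rw [show (2916 : ℝ) = 2 ^ 2 * 3 ^ 6 by norm_num, Real.log_mul (by norm_num) (by norm_num), Real.log_pow,
      Real.log_pow]; ring
  have l72 : Real.log 72 = 3 * Real.log 2 + 2 * Real.log 3 := by
    rw [show (72 : ℝ) = 2 ^ 3 * 3 ^ 2 by norm_num, Real.log_mul (by norm_num) (by norm_num), Real.log_pow,
      Real.log_pow]; ring
  have l35 : Real.log 35 = Real.log 5 + Real.log 7 := by
    rw [show (35 : ℝ) = 5 * 7 by norm_num, Real.log_mul (by norm_num) (by norm_num)]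
  have l36 : Real.log 36 = 2 * Real.log 2 + 2 * Real.log 3 := by
    rw [show (36 : ℝ) = 2 ^ 2 * 3 ^ 2 by norm_num, Real.log_mul (by norm_num) (by norm_num), Real.log_pow,
      Real.log_pow]; ring
  simp only [Real.negMulLog, Real.log_div (by norm_num : (7 : ℝ) ≠ 0) (by norm_num : (54 : ℝ) ≠ 0),
    Real.log_div (by norm_num : (2527 : ℝ) ≠ 0) (by norm_num : (5832 : ℝ) ≠ 0),
    Real.log_div (by norm_num : (100 : ℝ) ≠ 0) (by norm_num : (243 : ℝ) ≠ 0),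
    Real.log_div (by norm_num : (49 : ℝ) ≠ 0) (by norm_num : (1944 : ℝ) ≠ 0),
    Real.log_div (by norm_num : (1 : ℝ) ≠ 0) (by norm_num : (2916 : ℝ) ≠ 0),
    Real.log_div (by norm_num : (1 : ℝ) ≠ 0) (by norm_num : (72 : ℝ) ≠ 0),
    Real.log_div (by norm_num : (35 : ℝ) ≠ 0) (by norm_num : (36 : ℝ) ≠ 0), Real.log_one,
    l12, l38, l6, l54, l2527, l5832, l100, l243, l49, l1944, l2916, l72, l35, l36]
  norm_num at h3 h5 h7 h19 ⊢
  linarith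

end Logs

/-! ## The level-2 support, explicitly -/

section Support

/-- The fifteen elements of the level-2 support. [cite: CoppersmithWinograd1990, §8] -/
theorem cwSupport₂_eq : cwSupport₂ =
    {(0, 0, 4), (0, 4, 0), (4, 0, 0), (0, 1, 3), (0, 3, 1), (1, 0, 3), (1, 3, 0), (3, 0, 1), (3, 1, 0),
      (0, 2, 2), (2, 0, 2), (2, 2, 0), (1, 1, 2), (1, 2, 1), (2, 1, 1)} := by
  decide

end Support

/-! ## Coppersmith–Winograd's distribution for `q = 6` and the component values -/

section Data

/-- **The distribution on the level-2 blocks** (symmetric; per ordered block: `[004]`-type `1/2916`,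
`[013]`-type `49/3888`, `[022]`-type `605/5832`, `[112]`-type `595/2916`). [cite: CoppersmithWinograd1990, §8] -/
def cwP2 (s : Fin 5 × Fin 5 × Fin 5) : ℝ :=
  if (s.1 : ℕ) + s.2.1 + s.2.2 = 4 then
    (if max (s.1 : ℕ) (max s.2.1 s.2.2) = 4 then 1 / 2916
      else if max (s.1 : ℕ) (max s.2.1 s.2.2) = 3 then 49 / 3888
      else if min (s.1 : ℕ) (min s.2.1 s.2.2) = 0 then 605 / 5832 else 595 / 2916)
  else 0

/-- The `z`-marginal entropy of the `[112]` sub-distribution at `σ = 35/36`, in bits. [folklore] -/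
def cwHZ : ℝ := (2 * negMulLog ((1 - 35 / 36) / 2) + negMulLog (35 / 36 : ℝ)) / Real.log 2

/-- The value of `[112]` at `q = 6`, `ρ = 2.3759`, `σ = 35/36` (Le Gall's normalisation). [cite: CoppersmithWinograd1990, §8] -/
def cwU112' : ℝ := (2 : ℝ) ^ ((2 + cwHZ) / 3) * ((6 : ℕ) : ℝ) ^ ((2.3759 : ℝ) / 3 * (1 + 35 / 36))

/-- **The component values** `u(s)`: `1`, `(2q)^{ρ/3}`, `(q²+2)^{ρ/3}`, `V([112])`. [cite: CoppersmithWinograd1990, §8] -/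
def cwU2 (s : Fin 5 × Fin 5 × Fin 5) : ℝ :=
  if max (s.1 : ℕ) (max s.2.1 s.2.2) = 4 then 1
  else if max (s.1 : ℕ) (max s.2.1 s.2.2) = 3 then (((2 * 6 : ℕ) : ℝ)) ^ ((2.3759 : ℝ) / 3)
  else if min (s.1 : ℕ) (min s.2.1 s.2.2) = 0 then (((6 * 6 + 2 : ℕ) : ℝ)) ^ ((2.3759 : ℝ) / 3)
  else cwU112'

/-- `cwU112'³` is the bound of `hasLaserValue_symm3_cwSqComp112`. [folklore] -/
theorem cwU112'_cube : cwU112' ^ 3 = (2 : ℝ) ^ (2 + cwHZ) *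
    ((((6 : ℕ) : ℝ) ^ ((2.3759 : ℝ) / 3 * (1 + 35 / 36))) ^ 3) := by
  rw [cwU112', mul_pow, ← Real.rpow_natCast ((2 : ℝ) ^ ((2 + cwHZ) / 3)) 3, ← Real.rpow_mul zero_le_two]
  congr 2; push_cast; ring

/-- `u > 0`. [folklore] -/
theorem cwU2_pos (s : Fin 5 × Fin 5 × Fin 5) : 0 < cwU2 s := by
  simp only [cwU2, cwU112']
  split_ifs <;> positivity

/-- **The values of the fifteen components of `CW_6^{⊗2}`.** [cite: CoppersmithWinograd1990, §8] -/
theorem hasLaserValue_cwSupport₂ (K : Type u) [Field K] (s : Fin 5 × Fin 5 × Fin 5) (hs : s ∈ cwSupport₂) :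
    HasLaserValue (2.3759 : ℝ) (symm3 (cwSqComp K 6 s.1 s.2.1 s.2.2)) (cwU2 s ^ 3) := by
  have hσ0 : (0 : ℝ) < 35 / 36 := by norm_num
  have hσ1 : (35 / 36 : ℝ) < 1 := by norm_num
  have h112 : (2 : ℝ) ^ (2 + (2 * negMulLog ((1 - 35 / 36) / 2) + negMulLog (35 / 36 : ℝ)) / Real.log 2) *
      ((((6 : ℕ) : ℝ) ^ ((2.3759 : ℝ) / 3 * (1 + 35 / 36))) ^ 3) = cwU112' ^ 3 := by
    rw [cwU112'_cube, cwHZ]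
  -- the values at the fifteen blocks (evaluated away from the tensor terms)
  have v1 : ∀ a b c : Fin 5, max (a : ℕ) (max b c) = 4 → cwU2 (a, b, c) = 1 := fun a b c h => by
    simp only [cwU2, h, if_true]
  have v2 : ∀ a b c : Fin 5, max (a : ℕ) (max b c) = 3 →
      cwU2 (a, b, c) = (((2 * 6 : ℕ) : ℝ)) ^ ((2.3759 : ℝ) / 3) := fun a b c h => by
    simp only [cwU2, h]; norm_num
  have v3 : ∀ a b c : Fin 5, max (a : ℕ) (max b c) = 2 → min (a : ℕ) (min b c) = 0 →
      cwU2 (a, b, c) = (((6 * 6 + 2 : ℕ) : ℝ)) ^ ((2.3759 : ℝ) / 3) := fun a b c h h' => by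
    simp only [cwU2, h, h']; norm_num
  have v4 : ∀ a b c : Fin 5, max (a : ℕ) (max b c) = 2 → min (a : ℕ) (min b c) = 1 →
      cwU2 (a, b, c) = cwU112' := fun a b c h h' => by
    simp only [cwU2, h, h']; norm_num
  rw [cwSupport₂_eq] at hs
  simp only [Finset.mem_insert, Finset.mem_singleton] at hs
  rcases hs with rfl | rfl | rfl | rfl | rfl | rfl | rfl | rfl | rfl | rfl | rfl | rfl | rfl | rfl | rfl
  · rw [v1 _ _ _ (by decide), one_pow]; exact hasLaserValue_symm3_cwSqComp004 K 6 _
  · rw [v1 _ _ _ (by decide), one_pow]; exact hasLaserValue_symm3_cwSqComp040 K 6 _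
  · rw [v1 _ _ _ (by decide), one_pow]; exact hasLaserValue_symm3_cwSqComp400 K 6 _
  · rw [v2 _ _ _ (by decide)]; exact hasLaserValue_symm3_cwSqComp013 K 6 _
  · rw [v2 _ _ _ (by decide)]; exact hasLaserValue_symm3_cwSqComp031 K 6 _
  · rw [v2 _ _ _ (by decide)]; exact hasLaserValue_symm3_cwSqComp103 K 6 _
  · rw [v2 _ _ _ (by decide)]; exact hasLaserValue_symm3_cwSqComp130 K 6 _
  · rw [v2 _ _ _ (by decide)]; exact hasLaserValue_symm3_cwSqComp301 K 6 _
  · rw [v2 _ _ _ (by decide)]; exact hasLaserValue_symm3_cwSqComp310 K 6 _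
  · rw [v3 _ _ _ (by decide) (by decide)]; exact hasLaserValue_symm3_cwSqComp022 K 6 _
  · rw [v3 _ _ _ (by decide) (by decide)]; exact hasLaserValue_symm3_cwSqComp202 K 6 _
  · rw [v3 _ _ _ (by decide) (by decide)]; exact hasLaserValue_symm3_cwSqComp220 K 6 _
  · rw [v4 _ _ _ (by decide) (by decide), ← h112]
    exact hasLaserValue_symm3_cwSqComp112 K 6 (by norm_num) _ _ hσ0 hσ1
  · rw [v4 _ _ _ (by decide) (by decide), ← h112]
    exact hasLaserValue_symm3_cwSqComp121 K 6 (by norm_num) _ _ hσ0 hσ1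
  · rw [v4 _ _ _ (by decide) (by decide), ← h112]
    exact hasLaserValue_symm3_cwSqComp211 K 6 (by norm_num) _ _ hσ0 hσ1

/-! ### The distribution: mass, marginals, penalty -/

/-- `cwP2` vanishes off the level-2 support. [folklore] -/
theorem cwP2_eq_zero (s : Fin 5 × Fin 5 × Fin 5) (hs : s ∉ cwSupport₂) : cwP2 s = 0 := by
  rw [mem_cwSupport₂] at hs
  simp [cwP2, hs]

/-- `cwP2 ≥ 0`. [folklore] -/
theorem cwP2_nonneg (s : Fin 5 × Fin 5 × Fin 5) : 0 ≤ cwP2 s := by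
  simp only [cwP2]; split_ifs <;> norm_num

/-- `∑ cwP2 = 1` (`3α₀ + 6β₀ + 3γ₀ + 3δ₀ = 1`). [cite: CoppersmithWinograd1990, §8] -/
theorem sum_cwP2 : ∑ s, cwP2 s = 1 := by
  rw [← Finset.sum_subset (Finset.subset_univ cwSupport₂) (fun s _ hs => cwP2_eq_zero s hs), cwSupport₂_eq]
  repeat rw [Finset.sum_insert (by decide)]
  rw [Finset.sum_singleton]
  simp only [cwP2, Fin.isValue]
  norm_num

/-- **The marginal `P_X = (7/54, 2527/5832, 100/243, 49/1944, 1/2916)`.** [cite: CoppersmithWinograd1990, §8] -/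
def cwPX : Fin 5 → ℝ := ![7 / 54, 2527 / 5832, 100 / 243, 49 / 1944, 1 / 2916]

/-- The first marginal. [cite: CoppersmithWinograd1990, §8] -/
theorem marginalDist₁_cwP2 : marginalDist₁ cwP2 = cwPX := by
  funext I
  rw [marginalDist₁_eq_sum_filter cwSupport₂ cwP2_eq_zero, cwSupport₂_eq]
  fin_cases I <;> simp [Finset.filter_insert, Finset.filter_singleton, cwP2, cwPX] <;> norm_num

/-- The second marginal. [cite: CoppersmithWinograd1990, §8] -/
theorem marginalDist₂_cwP2 : marginalDist₂ cwP2 = cwPX := by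
  funext I
  rw [marginalDist₂_eq_sum_filter cwSupport₂ cwP2_eq_zero, cwSupport₂_eq]
  fin_cases I <;> simp [Finset.filter_insert, Finset.filter_singleton, cwP2, cwPX] <;> norm_num

/-- The third marginal. [cite: CoppersmithWinograd1990, §8] -/
theorem marginalDist₃_cwP2 : marginalDist₃ cwP2 = cwPX := by
  funext I
  rw [marginalDist₃_eq_sum_filter cwSupport₂ cwP2_eq_zero, cwSupport₂_eq]
  fin_cases I <;> simp [Finset.filter_insert, Finset.filter_singleton, cwP2, cwPX] <;> norm_num

/-- `H(P_X) ln 2 = ∑ η(P_X(I))`. [folklore] -/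
theorem shannonEntropy_cwPX : shannonEntropy cwPX * Real.log 2 =
    negMulLog (7 / 54 : ℝ) + negMulLog (2527 / 5832 : ℝ) + negMulLog (100 / 243 : ℝ) +
      negMulLog (49 / 1944 : ℝ) + negMulLog (1 / 2916 : ℝ) := by
  have hl : Real.log 2 ≠ 0 := (Real.log_pos one_lt_two).ne'
  rw [shannonEntropy_def, div_mul_cancel₀ _ hl, Fin.sum_univ_five]
  simp [cwPX]

/-- **`Γ = 0`: the distribution has product form `f(I) f(J) f(K)`** (`f(0) = 1`, `f(4) = α₀`,
`f(2) = √γ₀`, `f(1) = √(δ₀/√γ₀)`, `f(3) = β₀/f(1)`). [cite: LeGall2014, Prop. 4.1] -/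
theorem maxEntropyPenalty_cwP2 : maxEntropyPenalty cwSupport₂ cwP2 = 0 := by
  set f2 : ℝ := Real.sqrt (605 / 5832) with hf2
  have hf2pos : 0 < f2 := Real.sqrt_pos.2 (by norm_num)
  have hf2sq : f2 * f2 = 605 / 5832 := Real.mul_self_sqrt (by norm_num)
  set f1 : ℝ := Real.sqrt (595 / 2916 / f2) with hf1
  have hf1pos : 0 < f1 := Real.sqrt_pos.2 (by positivity)
  have hf1sq : f1 * f1 = 595 / 2916 / f2 := Real.mul_self_sqrt (by positivity)
  set f3 : ℝ := 49 / 3888 / f1 with hf3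
  have hf3pos : 0 < f3 := by positivity
  let f : Fin 5 → ℝ := fun I =>
    if (I : ℕ) = 0 then 1 else if (I : ℕ) = 1 then f1 else if (I : ℕ) = 2 then f2 else if (I : ℕ) = 3 then f3
      else 1 / 2916
  have hfpos : ∀ I, 0 < f I := by
    intro I
    simp only [f]
    split_ifs
    exacts [by norm_num, hf1pos, hf2pos, hf3pos, by norm_num]
  have e13 : f1 * f3 = 49 / 3888 := by rw [hf3]; field_simp
  have e112 : f1 * f1 * f2 = 595 / 2916 := by rw [hf1sq]; field_simp
  refine maxEntropyPenalty_eq_zero_of_mul cwSupport₂ ⟨cwP2_nonneg, sum_cwP2⟩ cwP2_eq_zero f f f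
    (fun x _ => hfpos _) (fun x _ => hfpos _) (fun x _ => hfpos _) fun s hs => ?_
  rw [cwSupport₂_eq] at hs
  simp only [Finset.mem_insert, Finset.mem_singleton] at hs
  rcases hs with rfl | rfl | rfl | rfl | rfl | rfl | rfl | rfl | rfl | rfl | rfl | rfl | rfl | rfl | rfl <;>
    simp only [cwP2, f, Fin.isValue] <;> norm_num <;> nlinarith [e13, e112, hf2sq]

end Data

/-! ## The theorem -/

section Main

/-- `R̃(CW_6 ⊗ CW_6) ≤ 64`. [cite: CoppersmithWinograd1990, §8] -/
theorem asymptoticRank_bigCwSq_six_le (K : Type u) [Field K] : asymptoticRank (bigCwSq K 6) ≤ 64 := by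
  have h := asymptoticRank_bigCwTensor_le K 6
  have h0 := asymptoticRank_nonneg (bigCwTensor K 6)
  calc asymptoticRank (bigCwSq K 6) ≤ asymptoticRank (bigCwTensor K 6) * asymptoticRank (bigCwTensor K 6) :=
        asymptoticRank_kronecker_le _ _
    _ ≤ 8 * 8 := mul_le_mul (by norm_num at h; linarith) (by norm_num at h; linarith) h0 (by norm_num)
    _ = 64 := by norm_num

/-- **Coppersmith–Winograd 1990, §8: `ω < 2.376`** (the square of `CW_6`; over every field).
[cite: CoppersmithWinograd1990, §8] -/
theorem CoppersmithWinograd1990_sec8 (K : Type u) [Field K] : omega K < 2.376 := by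
  suffices h : omega K ≤ 2.3759 by linarith
  have hval := hasLaserValue_cwSupport₂ K
  refine omega_le_of_laserMethodSym (bigCwSq K 6) cwLev2 cwLev2 cwLev2 cwSupport₂ (bigCwSq_cwSupport₂ K 6)
    cwTight₂ cwTight₂ cwTight₂γ cwTight₂_injective cwTight₂_injective cwTight₂γ_injective cwTight₂_bound
    cwTight₂_bound (fun l k => by
      have h1 := l.isLt
      simp only [cwTight₂γ]
      rw [abs_le]; constructor <;> push_cast <;> omega)
    cwTight₂_sum (by norm_num) cwU2 (fun s _ => cwU2_pos s) hval cwP2 cwP2_nonneg sum_cwP2 cwP2_eq_zero ?_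
  -- the final inequality
  rw [marginalDist₁_cwP2, marginalDist₂_cwP2, marginalDist₃_cwP2, maxEntropyPenalty_cwP2, mul_zero, sub_zero]
  -- `∏ u^P = exp (∑ P ln u)`
  have hprod : ∏ s ∈ cwSupport₂, cwU2 s ^ cwP2 s = Real.exp (∑ s ∈ cwSupport₂, cwP2 s * Real.log (cwU2 s)) := by
    rw [Real.exp_sum]
    exact Finset.prod_congr rfl fun s _ => by
      rw [Real.rpow_def_of_pos (cwU2_pos s), mul_comm]
  have hsum : ∑ s ∈ cwSupport₂, cwP2 s * Real.log (cwU2 s) =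
      (2.3759 : ℝ) / 3 * (6 * (49 / 3888 : ℝ) * Real.log 12 + 3 * (605 / 5832 : ℝ) * Real.log 38 +
          3 * (595 / 2916 : ℝ) * (1 + 35 / 36) * Real.log 6) +
        (595 / 2916 : ℝ) * (2 * Real.log 2 + 2 * negMulLog (1 / 72 : ℝ) + negMulLog (35 / 36 : ℝ)) := by
    have hl : Real.log 2 ≠ 0 := (Real.log_pos one_lt_two).ne'
    have lU : Real.log cwU112' = (2 + cwHZ) / 3 * Real.log 2 + (2.3759 : ℝ) / 3 * (1 + 35 / 36) * Real.log 6 := by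
      rw [cwU112', Real.log_mul (by positivity) (by positivity), Real.log_rpow two_pos, Real.log_rpow (by norm_num)]
      push_cast; ring
    have l12 : Real.log ((12 : ℝ) ^ ((23759 : ℝ) / 30000)) = (23759 : ℝ) / 30000 * Real.log 12 :=
      Real.log_rpow (by norm_num) _
    have l38 : Real.log ((38 : ℝ) ^ ((23759 : ℝ) / 30000)) = (23759 : ℝ) / 30000 * Real.log 38 :=
      Real.log_rpow (by norm_num) _
    rw [cwSupport₂_eq]
    repeat rw [Finset.sum_insert (by decide)]
    rw [Finset.sum_singleton]
    simp only [cwP2, cwU2, Fin.isValue]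
    norm_num
    have h72 : ((1 : ℝ) - 35 / 36) / 2 = 1 / 72 := by norm_num
    rw [l12, l38, lU, cwHZ, h72]
    field_simp
    ring
  have hcore := cw_square_numeric_core
  rw [← shannonEntropy_cwPX, ← hsum] at hcore
  -- compare the two sides through `exp`
  have hR := asymptoticRank_bigCwSq_six_le K
  have hR0 := asymptoticRank_nonneg (bigCwSq K 6)
  set Hx := shannonEntropy cwPX with hHx
  set Ls := ∑ s ∈ cwSupport₂, cwP2 s * Real.log (cwU2 s) with hLs
  have hlog2 := Real.log_pos one_lt_two
  calc asymptoticRank (bigCwSq K 6) ^ 3 ≤ (64 : ℝ) ^ 3 := by gcongr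
    _ = Real.exp (3 * (6 * Real.log 2)) := by
        rw [show (64 : ℝ) ^ 3 = 2 ^ (18 : ℕ) by norm_num, ← Real.exp_log (by norm_num : (0 : ℝ) < 2 ^ (18 : ℕ)),
          Real.log_pow]; push_cast; ring_nf
    _ < Real.exp (3 * (Hx * Real.log 2 + Ls)) := Real.exp_lt_exp.2 (by linarith)
    _ = (2 : ℝ) ^ (Hx + Hx + Hx) * (∏ s ∈ cwSupport₂, cwU2 s ^ cwP2 s) ^ 3 := by
        rw [hprod, ← Real.exp_nat_mul _ 3, Real.rpow_def_of_pos two_pos, ← Real.exp_add]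
        congr 1; push_cast; ring

end Main

end Literature.Computability.AlgebraicComplexity
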